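import Summits.ResolutionOfSingularities.ResolutionOfSingularities.Theorems.PAlterationPalterationThesisPialtOfPerfect
import Summits.ResolutionOfSingularities.ResolutionOfSingularities.Theorems.PAlterationPalterationThesisPerfectAssembly
import Summits.ResolutionOfSingularities.ResolutionOfSingularities.Theorems.PAlterationPalterationThesisIffSummit
import Summits.ResolutionOfSingularities.ResolutionOfSingularities.Theorems.PAlterationPialtProjective
import Summits.ResolutionOfSingularities.ResolutionOfSingularities.Theorems.PAlterationPialtNormalProjective
import Summits.ResolutionOfSingularities.ResolutionOfSingularities.Theses.Descent
import HarnessLib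

/-!
# Crux `PalterationThesis` (stmt-ResolutionOfSingularities-0552), line `Sketch`: the perfect-field transfer

Route `ResolutionOfSingularities/pAlteration`; helper file (`--supports stmt-0552`) closing the
registered glue stub `stub_perfectTransfer` of the line's skeleton
(`Cruxes/PalterationThesis/Lines/Sketch.lean`) and drawing the consequences of
`stub_pialtOfPerfect` (`PAlterationPalterationThesisPialtOfPerfect.lean`: PIAlt descends from the
perfect closure):

* `pialtAt_of_pialtAt_perfectClosure`, `pialt_of_pialt_perfectField`,
  `pialt_iff_pialt_perfectField` — **`Pialt` (item stmt-0555, the Abramovich–Oort conjecture in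
  characteristic `p`) is equivalent to its restriction to PERFECT ground fields**; with Chow and
  normalisation, to projective (resp. normal) varieties over perfect fields
  (`pialt_iff_forall_perfectField_isProjectiveOver`, `pialt_iff_forall_perfectField_normal`);
* the fieldwise sandwich `pialtOver_of_forall_hasResolution`, `picoverOver_of_forall_hasResolution`;
* `stub_perfectTransfer` — granted fieldwise Theorem A over perfect fields (the skeleton's
  `stub_perfectAssembly`), **the crux is equivalent to: PIAlt and PICover over perfect fields, and
  route Descent's `DescentPerfectToAll`** (stmt-0549); unconditionally, with the landed
  `stub_perfectAssembly`: `pialtOver_and_picoverOver_iff_perfectField` (over a perfect field the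
  two conjuncts ARE resolution), `palterationThesis_iff_perfect_and_descent`,
  `resolutionOfSingularities_iff_perfect_and_descent`;
* `palterationThesis_iff_pialtPerfect_and_picover`, `resolutionOfSingularities_iff_pialtPerfect_and_picover`,
  `palterationThesis_iff_pialtPerfect_and_picoverDegP` — the crux / the summit with the
  Abramovich–Oort conjunct over perfect fields (and the `Picover` half in degree `p`);
* `resolutionOfSingularities_iff_picover_of_perfectRes`, `descentPerfectToAll_iff_picover_of_perfectRes`
  — **if resolution is known over perfect fields, the summit (equivalently `DescentPerfectToAll`)
  is equivalent to `Picover`**: the imperfect-ground-field difficulty of resolution in positive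
  characteristic is entirely of PICover type, PIAlt descending unconditionally.
-/

-- single-problem summit: the doubled namespace component `ResolutionOfSingularities` is forced
set_option linter.dupNamespace false

noncomputable section

open CategoryTheory CategoryTheory.Limits AlgebraicGeometry TopologicalSpace
open Literature.AlgebraicGeometry.Resolution Scheme.IdealSheafData
open Summit.ResolutionOfSingularities.ResolutionOfSingularities.Theses.PAlteration
open Summit.ResolutionOfSingularities.ResolutionOfSingularities.Theses.Descent (DescentPerfectToAll)

namespace Summit.ResolutionOfSingularities.ResolutionOfSingularities.Theorems

/-! ## `Pialt` needs only perfect ground fields -/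

/-- **PIAlt over the perfect closure `k^{p^{-∞}}` implies PIAlt over `k`** (the registered stub
`PalterationThesis.PerfectTransfer.stub_pialtOfPerfect`, re-exported under a descriptive name).
[folklore] -/
theorem pialtAt_of_pialtAt_perfectClosure (p : ℕ) [Fact p.Prime] (k : Type) [Field k] [CharP k p]
    (hPIK : ∀ (X : Scheme.{0}) (f : X ⟶ Spec (.of (PerfectClosure k p))),
      IsSeparated f → LocallyOfFiniteType f → QuasiCompact f → IsIntegral X →
      ∃ (X' : Scheme.{0}) (g : X' ⟶ X), IsProper g ∧ IsIntegral X' ∧ Scheme.IsRegular X' ∧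
        Function.Surjective g.base ∧ ∃ U : X.Opens, Dense (U : Set X) ∧ IsFinite (g ∣_ U) ∧
        UniversallyInjective (g ∣_ U))
    (X : Scheme.{0}) (f : X ⟶ Spec (.of k)) [IsSeparated f] [LocallyOfFiniteType f]
    [QuasiCompact f] [IsIntegral X] :
    ∃ (X' : Scheme.{0}) (g : X' ⟶ X), IsProper g ∧ IsIntegral X' ∧ Scheme.IsRegular X' ∧
      Function.Surjective g.base ∧ ∃ U : X.Opens, Dense (U : Set X) ∧ IsFinite (g ∣_ U) ∧
      UniversallyInjective (g ∣_ U) :=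
  PalterationThesis.PerfectTransfer.stub_pialtOfPerfect p k hPIK X f

/-- **`Pialt` needs only perfect ground fields**: if, for every prime `p`, every integral
separated scheme of finite type over every PERFECT field of characteristic `p` admits a purely
inseparable regular alteration, then `Pialt` (item stmt-ResolutionOfSingularities-0555) holds.
[folklore] -/
theorem pialt_of_pialt_perfectField
    (h : ∀ p : ℕ, p.Prime → ∀ (K : Type) [Field K] [CharP K p] [PerfectField K]
      (X : Scheme.{0}) (f : X ⟶ Spec (.of K)),
      IsSeparated f → LocallyOfFiniteType f → QuasiCompact f → IsIntegral X →
      ∃ (X' : Scheme.{0}) (g : X' ⟶ X), IsProper g ∧ IsIntegral X' ∧ Scheme.IsRegular X' ∧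
        Function.Surjective g.base ∧ ∃ U : X.Opens, Dense (U : Set X) ∧ IsFinite (g ∣_ U) ∧
        UniversallyInjective (g ∣_ U)) :
    Pialt := by
  intro p hp k _ _ X f hs hl hq hi
  haveI : Fact p.Prime := ⟨hp⟩
  exact pialtAt_of_pialtAt_perfectClosure p k (h p hp (PerfectClosure k p)) X f

/-- **`Pialt` is equivalent to its restriction to perfect ground fields**: imperfect fields are
free for the Abramovich–Oort conjecture in characteristic `p` — its conclusion is insensitive to
exactly the inseparable ground-field extensions under which regularity is unstable (barrier
`Literature.Barriers.ResolutionOfSingularities.InseparableBaseChange`). [folklore] -/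
theorem pialt_iff_pialt_perfectField :
    Pialt ↔ ∀ p : ℕ, p.Prime → ∀ (K : Type) [Field K] [CharP K p] [PerfectField K]
      (X : Scheme.{0}) (f : X ⟶ Spec (.of K)),
      IsSeparated f → LocallyOfFiniteType f → QuasiCompact f → IsIntegral X →
      ∃ (X' : Scheme.{0}) (g : X' ⟶ X), IsProper g ∧ IsIntegral X' ∧ Scheme.IsRegular X' ∧
        Function.Surjective g.base ∧ ∃ U : X.Opens, Dense (U : Set X) ∧ IsFinite (g ∣_ U) ∧
        UniversallyInjective (g ∣_ U) :=
  ⟨fun h p hp K _ _ _ X f hs hl hq hi => h p hp K X f hs hl hq hi, pialt_of_pialt_perfectField⟩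

/-! ## The fieldwise sandwich -/

/-- PIAlt over a field `K` from resolution of the integral separated `K`-schemes of finite type
(a resolution is a purely inseparable alteration with regular source; Temkin 2013, §1 p. 3,
(i) ⊂ (iii)). [cite: Temkin2013, §1 p. 3 (i), (iii)] -/
theorem pialtOver_of_forall_hasResolution (K : Type) [Field K]
    (hres : ∀ (X : Scheme.{0}) (f : X ⟶ Spec (.of K)),
      IsSeparated f → LocallyOfFiniteType f → QuasiCompact f → IsIntegral X →
      Scheme.HasResolution X) :
    ∀ (X : Scheme.{0}) (f : X ⟶ Spec (.of K)),
      IsSeparated f → LocallyOfFiniteType f → QuasiCompact f → IsIntegral X →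
      ∃ (X' : Scheme.{0}) (g : X' ⟶ X), IsProper g ∧ IsIntegral X' ∧ Scheme.IsRegular X' ∧
        Function.Surjective g.base ∧ ∃ U : X.Opens, Dense (U : Set X) ∧ IsFinite (g ∣_ U) ∧
        UniversallyInjective (g ∣_ U) := by
  intro X f hs hl hq hi
  exact pialtConclusion_of_exists_isPurelyInseparableAlteration
    ((hres X f hs hl hq hi).exists_isPurelyInseparableAlteration_and_isRegular)

/-- PICover over a field `K` from resolution of the integral separated `K`-schemes of finite type
(a finite cover of a separated `K`-scheme of finite type is one). [folklore] -/
theorem picoverOver_of_forall_hasResolution (K : Type) [Field K]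
    (hres : ∀ (X : Scheme.{0}) (f : X ⟶ Spec (.of K)),
      IsSeparated f → LocallyOfFiniteType f → QuasiCompact f → IsIntegral X →
      Scheme.HasResolution X) :
    ∀ (Y X : Scheme.{0}) (f : Y ⟶ Spec (.of K)) (g : X ⟶ Y),
      IsSeparated f → LocallyOfFiniteType f → QuasiCompact f → IsIntegral Y →
      Scheme.IsRegular Y → IsIntegral X → IsFinite g → UniversallyInjective g →
      Function.Surjective g.base → Scheme.HasResolution X := by
  intro Y X f g hs hl hq _ _ hX hfin _ _
  haveI : IsAffineHom g := inferInstance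
  haveI : IsSeparated (g ≫ f) := inferInstance
  haveI : LocallyOfFiniteType (g ≫ f) := inferInstance
  haveI : QuasiCompact (g ≫ f) := inferInstance
  exact hres X (g ≫ f) inferInstance inferInstance inferInstance hX

/-! ## The transfer (registered glue stub of the skeleton) -/

namespace PalterationThesis.PerfectTransfer

/-- **Stub `stub_perfectTransfer` of line `Sketch`.** Granted fieldwise Theorem A over perfect
fields (hypothesis `hA`: PIAlt over `K` and PICover over `K`, `K` perfect, resolve every integral
variety over `K` — the skeleton's `stub_perfectAssembly`), the crux `PalterationThesis` is
EQUIVALENT to: PIAlt and PICover over the perfect fields of every prime characteristic, AND route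
Descent's `DescentPerfectToAll` (stmt-0549). Forward: the crux is the summit
(`palterationThesis_iff_resolutionOfSingularities`), which gives the perfect conjuncts by the
fieldwise sandwich and makes `DescentPerfectToAll` trivially true; backward: `hA` and reduced →
integral (`DescentReducedToIntegral_holds`) give resolution over perfect fields, Descent spreads
it to all fields, and the summit gives the crux. [folklore] -/
theorem stub_perfectTransfer
    (hA : ∀ (p : ℕ), p.Prime → ∀ (K : Type) [Field K] [CharP K p] [PerfectField K],
      (∀ (X : Scheme.{0}) (f : X ⟶ Spec (.of K)),
          IsSeparated f → LocallyOfFiniteType f → QuasiCompact f → IsIntegral X →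
          ∃ (X' : Scheme.{0}) (g : X' ⟶ X), IsProper g ∧ IsIntegral X' ∧ Scheme.IsRegular X' ∧
            Function.Surjective g.base ∧ ∃ U : X.Opens, Dense (U : Set X) ∧ IsFinite (g ∣_ U) ∧
            UniversallyInjective (g ∣_ U)) →
      (∀ (Y X : Scheme.{0}) (f : Y ⟶ Spec (.of K)) (g : X ⟶ Y),
          IsSeparated f → LocallyOfFiniteType f → QuasiCompact f → IsIntegral Y →
          Scheme.IsRegular Y → IsIntegral X → IsFinite g → UniversallyInjective g →
          Function.Surjective g.base → Scheme.HasResolution X) →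
        ∀ (X : Scheme.{0}) (f : X ⟶ Spec (.of K)),
          IsSeparated f → LocallyOfFiniteType f → QuasiCompact f → IsIntegral X →
          Scheme.HasResolution X) :
    PalterationThesis ↔
      (∀ p : ℕ, p.Prime → ∀ (K : Type) [Field K] [CharP K p] [PerfectField K],
        (∀ (X : Scheme.{0}) (f : X ⟶ Spec (.of K)),
          IsSeparated f → LocallyOfFiniteType f → QuasiCompact f → IsIntegral X →
          ∃ (X' : Scheme.{0}) (g : X' ⟶ X), IsProper g ∧ IsIntegral X' ∧ Scheme.IsRegular X' ∧
            Function.Surjective g.base ∧ ∃ U : X.Opens, Dense (U : Set X) ∧ IsFinite (g ∣_ U) ∧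
            UniversallyInjective (g ∣_ U)) ∧
        (∀ (Y X : Scheme.{0}) (f : Y ⟶ Spec (.of K)) (g : X ⟶ Y),
          IsSeparated f → LocallyOfFiniteType f → QuasiCompact f → IsIntegral Y →
          Scheme.IsRegular Y → IsIntegral X → IsFinite g → UniversallyInjective g →
          Function.Surjective g.base → Scheme.HasResolution X)) ∧
      DescentPerfectToAll := by
  rw [palterationThesis_iff_resolutionOfSingularities]
  constructor
  · intro h
    refine ⟨fun p hp K _ _ _ => ?_, fun p hp _ => h p hp⟩
    have hint : ∀ (X : Scheme.{0}) (f : X ⟶ Spec (.of K)),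
        IsSeparated f → LocallyOfFiniteType f → QuasiCompact f → IsIntegral X →
        Scheme.HasResolution X := fun X f hs hl hq hi => by
      haveI := hi
      exact h p hp K X f hs hl hq inferInstance
    exact ⟨pialtOver_of_forall_hasResolution K hint, picoverOver_of_forall_hasResolution K hint⟩
  · rintro ⟨hperf, hD⟩ p hp
    refine hD p hp fun K _ _ _ X f hs hl hq hr => ?_
    exact DescentReducedToIntegral_holds K (fun Y g h1 h2 h3 h4 =>
      hA p hp K (hperf p hp K).1 (hperf p hp K).2 Y g h1 h2 h3 h4) X f hs hl hq hr

end PalterationThesis.PerfectTransfer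

/-! ## The transfer made unconditional by fieldwise Theorem A (`stub_perfectAssembly`, landed) -/

namespace PalterationThesis.PerfectTransfer

/-- **Over a perfect field `K` of characteristic `p`, PIAlt over `K` together with PICover over
`K` is EQUIVALENT to resolution of singularities of every reduced separated `K`-scheme of finite
type** (forward: fieldwise Theorem A and reduced → integral; backward: the fieldwise sandwich).
[folklore] -/
theorem pialtOver_and_picoverOver_iff_perfectField (p : ℕ) (hp : p.Prime) (K : Type) [Field K]
    [CharP K p] [PerfectField K] :
    ((∀ (X : Scheme.{0}) (f : X ⟶ Spec (.of K)),
          IsSeparated f → LocallyOfFiniteType f → QuasiCompact f → IsIntegral X →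
          ∃ (X' : Scheme.{0}) (g : X' ⟶ X), IsProper g ∧ IsIntegral X' ∧ Scheme.IsRegular X' ∧
            Function.Surjective g.base ∧ ∃ U : X.Opens, Dense (U : Set X) ∧ IsFinite (g ∣_ U) ∧
            UniversallyInjective (g ∣_ U)) ∧
      (∀ (Y X : Scheme.{0}) (f : Y ⟶ Spec (.of K)) (g : X ⟶ Y),
          IsSeparated f → LocallyOfFiniteType f → QuasiCompact f → IsIntegral Y →
          Scheme.IsRegular Y → IsIntegral X → IsFinite g → UniversallyInjective g →
          Function.Surjective g.base → Scheme.HasResolution X)) ↔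
    ∀ (X : Scheme.{0}) (f : X ⟶ Spec (.of K)),
      IsSeparated f → LocallyOfFiniteType f → QuasiCompact f → IsReduced X →
      Scheme.HasResolution X := by
  constructor
  · rintro ⟨hPI, hPC⟩ X f hs hl hq hr
    exact DescentReducedToIntegral_holds K (fun Y g h1 h2 h3 h4 => by
      haveI := h1; haveI := h2; haveI := h3; haveI := h4
      exact stub_perfectAssembly p hp K hPI hPC Y g) X f hs hl hq hr
  · intro h
    have hint : ∀ (X : Scheme.{0}) (f : X ⟶ Spec (.of K)),
        IsSeparated f → LocallyOfFiniteType f → QuasiCompact f → IsIntegral X →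
        Scheme.HasResolution X := fun X f hs hl hq hi => by
      haveI := hi
      exact h X f hs hl hq inferInstance
    exact ⟨pialtOver_of_forall_hasResolution K hint, picoverOver_of_forall_hasResolution K hint⟩

/-- **The crux `PalterationThesis` is equivalent to: PIAlt and PICover over PERFECT fields of
every prime characteristic, and route Descent's `DescentPerfectToAll`** — the composition
`PalterationThesis_of` of line `Sketch`, unconditionally (its three remaining stubs are exactly
the open items stmt-0555 / stmt-0554 over perfect fields and stmt-0549). [folklore] -/
theorem palterationThesis_iff_perfect_and_descent :
    PalterationThesis ↔
      (∀ p : ℕ, p.Prime → ∀ (K : Type) [Field K] [CharP K p] [PerfectField K],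
        (∀ (X : Scheme.{0}) (f : X ⟶ Spec (.of K)),
          IsSeparated f → LocallyOfFiniteType f → QuasiCompact f → IsIntegral X →
          ∃ (X' : Scheme.{0}) (g : X' ⟶ X), IsProper g ∧ IsIntegral X' ∧ Scheme.IsRegular X' ∧
            Function.Surjective g.base ∧ ∃ U : X.Opens, Dense (U : Set X) ∧ IsFinite (g ∣_ U) ∧
            UniversallyInjective (g ∣_ U)) ∧
        (∀ (Y X : Scheme.{0}) (f : Y ⟶ Spec (.of K)) (g : X ⟶ Y),
          IsSeparated f → LocallyOfFiniteType f → QuasiCompact f → IsIntegral Y →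
          Scheme.IsRegular Y → IsIntegral X → IsFinite g → UniversallyInjective g →
          Function.Surjective g.base → Scheme.HasResolution X)) ∧
      DescentPerfectToAll :=
  stub_perfectTransfer fun p hp K _ _ _ hPI hPC X f hs hl hq hi => by
    haveI := hs; haveI := hl; haveI := hq; haveI := hi
    exact stub_perfectAssembly p hp K hPI hPC X f

/-- **Resolution of singularities in positive characteristic is equivalent to: PIAlt and PICover
over perfect fields, and `DescentPerfectToAll`.** [folklore] -/
theorem resolutionOfSingularities_iff_perfect_and_descent :
    _root_.ResolutionOfSingularities ↔
      (∀ p : ℕ, p.Prime → ∀ (K : Type) [Field K] [CharP K p] [PerfectField K],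
        (∀ (X : Scheme.{0}) (f : X ⟶ Spec (.of K)),
          IsSeparated f → LocallyOfFiniteType f → QuasiCompact f → IsIntegral X →
          ∃ (X' : Scheme.{0}) (g : X' ⟶ X), IsProper g ∧ IsIntegral X' ∧ Scheme.IsRegular X' ∧
            Function.Surjective g.base ∧ ∃ U : X.Opens, Dense (U : Set X) ∧ IsFinite (g ∣_ U) ∧
            UniversallyInjective (g ∣_ U)) ∧
        (∀ (Y X : Scheme.{0}) (f : Y ⟶ Spec (.of K)) (g : X ⟶ Y),
          IsSeparated f → LocallyOfFiniteType f → QuasiCompact f → IsIntegral Y →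
          Scheme.IsRegular Y → IsIntegral X → IsFinite g → UniversallyInjective g →
          Function.Surjective g.base → Scheme.HasResolution X)) ∧
      DescentPerfectToAll :=
  palterationThesis_iff_resolutionOfSingularities.symm.trans palterationThesis_iff_perfect_and_descent

end PalterationThesis.PerfectTransfer

/-! ## The crux and the summit with the Abramovich–Oort conjunct over perfect fields -/

/-- **`PalterationThesis ↔ (Pialt over perfect fields) ∧ Picover`.** [folklore] -/
theorem palterationThesis_iff_pialtPerfect_and_picover :
    PalterationThesis ↔
      (∀ p : ℕ, p.Prime → ∀ (K : Type) [Field K] [CharP K p] [PerfectField K]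
        (X : Scheme.{0}) (f : X ⟶ Spec (.of K)),
        IsSeparated f → LocallyOfFiniteType f → QuasiCompact f → IsIntegral X →
        ∃ (X' : Scheme.{0}) (g : X' ⟶ X), IsProper g ∧ IsIntegral X' ∧ Scheme.IsRegular X' ∧
          Function.Surjective g.base ∧ ∃ U : X.Opens, Dense (U : Set X) ∧ IsFinite (g ∣_ U) ∧
          UniversallyInjective (g ∣_ U)) ∧ Picover :=
  palterationThesis_iff_pialt_and_picover.trans (and_congr_left' pialt_iff_pialt_perfectField)

/-- **Resolution of singularities in positive characteristic ↔ (the Abramovich–Oort conjecture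
in characteristic `p` over PERFECT fields) ∧ (resolution of finite radicial covers of regular
varieties).** [folklore] -/
theorem resolutionOfSingularities_iff_pialtPerfect_and_picover :
    _root_.ResolutionOfSingularities ↔
      (∀ p : ℕ, p.Prime → ∀ (K : Type) [Field K] [CharP K p] [PerfectField K]
        (X : Scheme.{0}) (f : X ⟶ Spec (.of K)),
        IsSeparated f → LocallyOfFiniteType f → QuasiCompact f → IsIntegral X →
        ∃ (X' : Scheme.{0}) (g : X' ⟶ X), IsProper g ∧ IsIntegral X' ∧ Scheme.IsRegular X' ∧
          Function.Surjective g.base ∧ ∃ U : X.Opens, Dense (U : Set X) ∧ IsFinite (g ∣_ U) ∧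
          UniversallyInjective (g ∣_ U)) ∧ Picover :=
  palterationThesis_iff_resolutionOfSingularities.symm.trans palterationThesis_iff_pialtPerfect_and_picover

/-! ## If resolution is known over perfect fields, the rest is PICover -/

/-- **If every reduced separated scheme of finite type over every PERFECT field of positive
characteristic has a resolution, then resolution of singularities over ALL fields of positive
characteristic is equivalent to `Picover`** (resolution of finite radicial covers of regular
varieties, over all fields): the Abramovich–Oort conjunct descends from the perfect closure
unconditionally (`pialt_of_pialt_perfectField`), so the imperfect-ground-field difficulty of the
summit is entirely of PICover type. [folklore] -/
theorem resolutionOfSingularities_iff_picover_of_perfectRes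
    (hperf : ∀ p : ℕ, p.Prime → ∀ (K : Type) [Field K] [CharP K p] [PerfectField K]
      (X : Scheme.{0}) (f : X ⟶ Spec (.of K)),
      IsSeparated f → LocallyOfFiniteType f → QuasiCompact f → IsReduced X →
      Scheme.HasResolution X) :
    _root_.ResolutionOfSingularities ↔ Picover := by
  refine ⟨picover_of_resolutionOfSingularities, fun hPc => ?_⟩
  refine resolutionOfSingularities_iff_pialt_and_picover.2 ⟨pialt_of_pialt_perfectField ?_, hPc⟩
  intro p hp K _ _ _
  refine pialtOver_of_forall_hasResolution K fun X f hs hl hq hi => ?_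
  haveI := hi
  exact hperf p hp K X f hs hl hq inferInstance

/-- Under the same hypothesis (resolution over perfect fields), route Descent's item
`DescentPerfectToAll` is equivalent to `Picover`. [folklore] -/
theorem descentPerfectToAll_iff_picover_of_perfectRes
    (hperf : ∀ p : ℕ, p.Prime → ∀ (K : Type) [Field K] [CharP K p] [PerfectField K]
      (X : Scheme.{0}) (f : X ⟶ Spec (.of K)),
      IsSeparated f → LocallyOfFiniteType f → QuasiCompact f → IsReduced X →
      Scheme.HasResolution X) :
    DescentPerfectToAll ↔ Picover := by
  rw [← resolutionOfSingularities_iff_picover_of_perfectRes hperf]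
  exact ⟨fun hD p hp => hD p hp (fun K _ _ _ X f hs hl hq hr => hperf p hp K X f hs hl hq hr),
    fun h p hp _ => h p hp⟩

/-- The crux with BOTH halves cut down: `PalterationThesis ↔ (Pialt over perfect fields) ∧
(Picover in degree p)` — combining `pialt_iff_pialt_perfectField` with the degree-`p` residue
`picover_iff_picoverDegP` of the `Picover` line `degree-p-tower`. [folklore] -/
theorem palterationThesis_iff_pialtPerfect_and_picoverDegP :
    PalterationThesis ↔
      (∀ p : ℕ, p.Prime → ∀ (K : Type) [Field K] [CharP K p] [PerfectField K]
        (X : Scheme.{0}) (f : X ⟶ Spec (.of K)),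
        IsSeparated f → LocallyOfFiniteType f → QuasiCompact f → IsIntegral X →
        ∃ (X' : Scheme.{0}) (g : X' ⟶ X), IsProper g ∧ IsIntegral X' ∧ Scheme.IsRegular X' ∧
          Function.Surjective g.base ∧ ∃ U : X.Opens, Dense (U : Set X) ∧ IsFinite (g ∣_ U) ∧
          UniversallyInjective (g ∣_ U)) ∧
      (∀ (p : ℕ), p.Prime → ∀ (k : Type) [Field k] [CharP k p] (W : Scheme.{0}) [IsIntegral W]
        (f : W ⟶ Spec (.of k)) (L : Type) [Field L] [Algebra W.functionField L],
        IsSeparated f → LocallyOfFiniteType f → QuasiCompact f → Scheme.IsRegular W →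
        IsPurelyInseparable W.functionField L → Module.finrank W.functionField L = p →
        Scheme.HasResolution (normalizationIn W L)) :=
  palterationThesis_iff_pialt_and_picoverDegP.trans (and_congr_left' pialt_iff_pialt_perfectField)


/-! ## Where a counterexample to `Pialt` may be sought -/

/-- **`Pialt` is equivalent to its restriction to PROJECTIVE varieties over PERFECT fields**
(`pialt_iff_pialt_perfectField` + Chow, `pialtConclusion_of_forall_isProjectiveOver`): a
counterexample to the Abramovich–Oort conjecture in characteristic `p`, if any, may be taken to be
an integral projective variety over a perfect field (of dimension `≥ 4`, `pialt_dim_le_three`).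
[folklore] -/
theorem pialt_iff_forall_perfectField_isProjectiveOver :
    Pialt ↔ ∀ p : ℕ, p.Prime → ∀ (K : Type) [Field K] [CharP K p] [PerfectField K]
      (X : Scheme.{0}) (f : X ⟶ Spec (.of K)), IsIntegral X →
        Literature.AlgebraicGeometry.Motives.IsProjectiveOver (Over.mk f) →
          ∃ (X' : Scheme.{0}) (g : X' ⟶ X), IsProper g ∧ IsIntegral X' ∧ Scheme.IsRegular X' ∧
            Function.Surjective g.base ∧ ∃ U : X.Opens, Dense (U : Set X) ∧ IsFinite (g ∣_ U) ∧
              UniversallyInjective (g ∣_ U) := by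
  refine ⟨fun h p hp K _ _ _ X f hi hproj => ?_, fun h => ?_⟩
  · haveI := isProper_of_isProjectiveOver f hproj
    exact h p hp K X f inferInstance inferInstance inferInstance hi
  · refine pialt_of_pialt_perfectField fun p hp K _ _ _ X f hs hl hq hi => ?_
    haveI := hs; haveI := hl; haveI := hq; haveI := hi
    exact pialtConclusion_of_forall_isProjectiveOver f fun X' f' hi' hproj =>
      h p hp K X' f' hi' hproj

/-- **`Pialt` is equivalent to its restriction to NORMAL varieties over PERFECT fields**
(`pialt_iff_pialt_perfectField` + normalisation, `abramovichOort_of_forall_normal`).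
[folklore] -/
theorem pialt_iff_forall_perfectField_normal :
    Pialt ↔ ∀ p : ℕ, p.Prime → ∀ (K : Type) [Field K] [CharP K p] [PerfectField K]
      (X : Scheme.{0}) (f : X ⟶ Spec (.of K)),
      IsSeparated f → LocallyOfFiniteType f → QuasiCompact f → IsIntegral X →
        (∀ x : X, IsIntegrallyClosed (X.presheaf.stalk x)) →
          ∃ (X' : Scheme.{0}) (g : X' ⟶ X), IsProper g ∧ IsIntegral X' ∧ Scheme.IsRegular X' ∧
            Function.Surjective g.base ∧ ∃ U : X.Opens, Dense (U : Set X) ∧ IsFinite (g ∣_ U) ∧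
              UniversallyInjective (g ∣_ U) := by
  refine ⟨fun h p hp K _ _ _ X f hs hl hq hi _ => h p hp K X f hs hl hq hi, fun h => ?_⟩
  refine pialt_of_pialt_perfectField fun p hp K _ _ _ X f hs hl hq hi => ?_
  haveI := hs; haveI := hl; haveI := hq; haveI := hi
  refine pialtConclusion_of_exists_isPurelyInseparableAlteration
    (abramovichOort_of_forall_normal K (fun Y g h1 h2 h3 h4 hn => ?_) X f)
  haveI := h4
  exact exists_isPurelyInseparableAlteration_of_pialtConclusion (h p hp K Y g h1 h2 h3 h4 hn)

/-- **`Pialt` ⇔ `Pialt` for NORMAL PROJECTIVE varieties over PERFECT fields.** [folklore] -/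
theorem pialt_iff_forall_perfectField_normal_isProjectiveOver :
    Pialt ↔ ∀ p : ℕ, p.Prime → ∀ (K : Type) [Field K] [CharP K p] [PerfectField K]
      (X : Scheme.{0}) (f : X ⟶ Spec (.of K)), IsIntegral X →
        Literature.AlgebraicGeometry.Motives.IsProjectiveOver (Over.mk f) →
          (∀ x : X, IsIntegrallyClosed (X.presheaf.stalk x)) →
            ∃ (X' : Scheme.{0}) (g : X' ⟶ X), IsProper g ∧ IsIntegral X' ∧ Scheme.IsRegular X' ∧
              Function.Surjective g.base ∧ ∃ U : X.Opens, Dense (U : Set X) ∧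
                IsFinite (g ∣_ U) ∧ UniversallyInjective (g ∣_ U) :=
  ⟨fun h p hp K _ _ _ X f hi hproj _ => haveI := isProper_of_isProjectiveOver f hproj
      h p hp K X f inferInstance inferInstance inferInstance hi,
    fun h => pialt_of_pialt_perfectField fun p hp K _ _ _ X f hs hl hq hi =>
      @pialtConclusion_of_forall_normal_isProjectiveOver K _ X f hs hl hq hi (h p hp K)⟩

end Summit.ResolutionOfSingularities.ResolutionOfSingularities.Theorems

end
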